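import Summits.AtomisticToContinuum.HydrodynamicLimit.Theorems.KineticFluxLdDecay.Negative.TiltLowerBound
import Summits.AtomisticToContinuum.HydrodynamicLimit.Theses.AntiMazurCoboundaries
import Literature.NumberTheory.LFunctions.PrimeReciprocalWindows

/-!
# Gibbs tilts for `KineticFluxLdDecay` (3/5): witness calculus and the abstract admissibility clause

(G) exact one-dimensional Gaussian computations `E cos(t + a wᵢ) = e^{-a²/2} cos t`, `E sin(t + a wᵢ) =
e^{-a²/2} sin t`, and the tilt costs `∫ llr1 = -‖u₁‖²/2` (drift), `(3/2)(log θ₁ − (θ₁ − 1))` (temperature);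
(H) integrability and elementary numerical bounds (`x/2 ≤ 1 − e^{-x}` is REUSED from
`Literature.NumberTheory.LFunctions.PrimeReciprocal.half_le_one_sub_exp_neg`); then `KineticFluxLdDecayWith P` — the crux VERBATIM with the
admissibility of `g` abstracted to `P κ g` —, its relation to the crux, anti-monotonicity, the unpacking at the
reference point (`a = θ = 1`, `u₀ = 0`, `φ ≡ 1`, regular flow) and `gamma_le` (tilt functional `≤ δ`).
refuter-cdisprove-stmt-AtomisticToContinuum-10967-0.
-/

noncomputable section

open MeasureTheory ProbabilityTheory Real
open scoped ENNReal InnerProductSpace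

namespace Summit.AtomisticToContinuum.HydrodynamicLimit.Theorems
namespace KineticFluxLdDecayTilt

/-! ### G. One-dimensional Gaussian computations for the three witnesses -/

section Witness

open Literature.Analysis.FluidPDE Literature.MathematicalPhysics.KineticTheory

/-- A bounded continuous function is integrable under the standard Gaussian. [folklore] -/
theorem integrable_of_abs_le_stdGaussian {f : V3 → ℝ} (hf : Continuous f) {C : ℝ}
    (hC : ∀ v, |f v| ≤ C) : Integrable f (stdGaussian V3) :=
  (integrable_const C).mono' hf.aestronglyMeasurable (ae_of_all _ fun v => by
    rw [Real.norm_eq_abs]; exact hC v)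

/-- Coordinates are continuous on `ℝ³`. [folklore] -/
theorem continuous_coord (i : Fin 3) : Continuous fun v : V3 => v i :=
  (EuclideanSpace.proj (𝕜 := ℝ) i).continuous

/-- `a · wᵢ = ⟪w, a eᵢ⟫`. [folklore] -/
theorem mul_coord_eq_inner (i : Fin 3) (a : ℝ) (w : V3) :
    a * w i = ⟪w, EuclideanSpace.single i a⟫_ℝ := by
  rw [EuclideanSpace.inner_single_right]
  simp

/-- `E cos(t + a wᵢ) = e^{-a²/2} cos t` under the standard Gaussian on `ℝ³`. [folklore] -/
theorem integral_cos_coord (i : Fin 3) (a t : ℝ) :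
    ∫ w, Real.cos (t + a * w i) ∂stdGaussian V3 = Real.exp (-a ^ 2 / 2) * Real.cos t := by
  simp_rw [mul_coord_eq_inner i a, Real.cos_add]
  have hc : Integrable (fun w : V3 => Real.cos t * Real.cos ⟪w, EuclideanSpace.single i a⟫_ℝ)
      (stdGaussian V3) :=
    integrable_of_abs_le_stdGaussian (by fun_prop) (C := 1) fun v => by
      rw [abs_mul]; exact mul_le_one₀ (Real.abs_cos_le_one _) (abs_nonneg _) (Real.abs_cos_le_one _)
  have hs : Integrable (fun w : V3 => Real.sin t * Real.sin ⟪w, EuclideanSpace.single i a⟫_ℝ)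
      (stdGaussian V3) :=
    integrable_of_abs_le_stdGaussian (by fun_prop) (C := 1) fun v => by
      rw [abs_mul]; exact mul_le_one₀ (Real.abs_sin_le_one _) (abs_nonneg _) (Real.abs_sin_le_one _)
  rw [integral_sub hc hs, integral_const_mul, integral_const_mul, integral_cos_inner_stdGaussian,
    integral_sin_inner_stdGaussian]
  simp [PiLp.norm_single, sq_abs, mul_comm]

/-- `E sin(t + a wᵢ) = e^{-a²/2} sin t` under the standard Gaussian on `ℝ³`. [folklore] -/
theorem integral_sin_coord (i : Fin 3) (a t : ℝ) :
    ∫ w, Real.sin (t + a * w i) ∂stdGaussian V3 = Real.exp (-a ^ 2 / 2) * Real.sin t := by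
  simp_rw [mul_coord_eq_inner i a, Real.sin_add]
  have hc : Integrable (fun w : V3 => Real.sin t * Real.cos ⟪w, EuclideanSpace.single i a⟫_ℝ)
      (stdGaussian V3) :=
    integrable_of_abs_le_stdGaussian (by fun_prop) (C := 1) fun v => by
      rw [abs_mul]; exact mul_le_one₀ (Real.abs_sin_le_one _) (abs_nonneg _) (Real.abs_cos_le_one _)
  have hs : Integrable (fun w : V3 => Real.cos t * Real.sin ⟪w, EuclideanSpace.single i a⟫_ℝ)
      (stdGaussian V3) :=
    integrable_of_abs_le_stdGaussian (by fun_prop) (C := 1) fun v => by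
      rw [abs_mul]; exact mul_le_one₀ (Real.abs_cos_le_one _) (abs_nonneg _) (Real.abs_sin_le_one _)
  rw [integral_add hc hs, integral_const_mul, integral_const_mul, integral_cos_inner_stdGaussian,
    integral_sin_inner_stdGaussian]
  simp [PiLp.norm_single, sq_abs, mul_comm]

/-- The cost of a DRIFT tilt: `∫ llr1 1 u₁ (u₁ + w) dγ = -‖u₁‖²/2` (`= -KL(N(u₁,1) ‖ N(0,1))`).
[folklore] -/
theorem integral_llr1_drift (u₁ : V3) :
    ∫ w, llr1 1 u₁ (u₁ + Real.sqrt 1 • w) ∂stdGaussian V3 = -‖u₁‖ ^ 2 / 2 := by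
  have hpt : ∀ w : V3, llr1 1 u₁ (u₁ + Real.sqrt 1 • w) = -‖u₁‖ ^ 2 / 2 + -⟪u₁, w⟫_ℝ := by
    intro w
    rw [llr1_eq one_pos, Real.sqrt_one, one_smul, Real.log_one, add_sub_cancel_left,
      norm_add_sq_real]
    ring
  simp_rw [hpt]
  have hin0 : Integrable (fun w : V3 => ⟪u₁, w⟫_ℝ) (stdGaussian V3) := by
    have h := memLp_one_iff_integrable.1
      (IsGaussian.memLp_dual (stdGaussian V3) (innerSL ℝ u₁) 1 (by simp))
    exact h.congr (ae_of_all _ fun w => by simp)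
  have hin : Integrable (fun w : V3 => -⟪u₁, w⟫_ℝ) (stdGaussian V3) := hin0.neg
  rw [integral_add (integrable_const _) hin, integral_const, integral_neg,
    integral_eq_zero_of_odd_stdGaussian (f := fun w : V3 => ⟪u₁, w⟫_ℝ)
      (fun w => by rw [inner_neg_right])]
  simp

/-- The cost of a TEMPERATURE tilt: `∫ llr1 θ₁ 0 (√θ₁ w) dγ = (3/2)(log θ₁ - (θ₁ - 1))`
(`= -KL(N(0,θ₁) ‖ N(0,1))`). [folklore] -/
theorem integral_llr1_temp {θ₁ : ℝ} (hθ₁ : 0 < θ₁) :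
    ∫ w, llr1 θ₁ 0 ((0 : V3) + Real.sqrt θ₁ • w) ∂stdGaussian V3 =
      3 / 2 * Real.log θ₁ - 3 / 2 * (θ₁ - 1) := by
  have hpt : ∀ w : V3, llr1 θ₁ 0 ((0 : V3) + Real.sqrt θ₁ • w) =
      3 / 2 * Real.log θ₁ + (1 - θ₁) / 2 * ‖w‖ ^ 2 := by
    intro w
    rw [llr1_eq hθ₁, zero_add, sub_zero, norm_smul, mul_pow, Real.norm_eq_abs, sq_abs,
      Real.sq_sqrt hθ₁.le]
    field_simp
    ring
  simp_rw [hpt]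
  rw [integral_add (integrable_const _) (integrable_norm_sq_stdGaussian.const_mul _),
    integral_const, integral_const_mul, integral_norm_sq_stdGaussian]
  simp
  ring

end Witness


/-! ### H. Integrability of the tilted integrands and elementary numerical bounds -/

section Helpers

open Literature.Analysis.FluidPDE Literature.MathematicalPhysics.KineticTheory

/-- `llr1` composed with the tilt map is integrable under the standard Gaussian. [folklore] -/
theorem integrable_llr1_comp_shift {θ₁ : ℝ} (hθ₁ : 0 < θ₁) (u₁ : V3) :
    Integrable (fun w : V3 => llr1 θ₁ u₁ (u₁ + Real.sqrt θ₁ • w)) (stdGaussian V3) := by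
  have hmp : MeasurePreserving (fun w : V3 => u₁ + Real.sqrt θ₁ • w) (stdGaussian V3)
      (gaussMeasure u₁ θ₁) := ⟨measurable_gaussShift u₁ θ₁, rfl⟩
  exact (hmp.integrable_comp (integrable_llr1 hθ₁ u₁).aestronglyMeasurable).2 (integrable_llr1 hθ₁ u₁)

/-- A bounded continuous `g` composed with the tilt map is integrable under the standard Gaussian.
[folklore] -/
theorem integrable_comp_shift_of_abs_le {g : V3 → ℝ} (hg : Continuous g) {K : ℝ}
    (hgK : ∀ v, |g v| ≤ K) (u₁ : V3) (θ₁ : ℝ) :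
    Integrable (fun w : V3 => g (u₁ + Real.sqrt θ₁ • w)) (stdGaussian V3) :=
  integrable_of_abs_le_stdGaussian (by fun_prop) fun v => hgK _

/-- `⟪b, ·⟫` is integrable under the standard Gaussian. [folklore] -/
theorem integrable_inner_stdGaussian (b : V3) :
    Integrable (fun v : V3 => ⟪b, v⟫_ℝ) (stdGaussian V3) := by
  have h := memLp_one_iff_integrable.1
    (IsGaussian.memLp_dual (stdGaussian V3) (innerSL ℝ b) 1 (by simp))
  exact h.congr (ae_of_all _ fun w => by simp)

/-- `sin t ≥ (3/4) t` on `[0, 1]`. [folklore] -/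
theorem three_quarters_mul_le_sin {t : ℝ} (ht0 : 0 ≤ t) (ht1 : t ≤ 1) : 3 / 4 * t ≤ Real.sin t := by
  have hb := Real.sin_bound (show |t| ≤ 1 by rwa [abs_of_nonneg ht0])
  rw [abs_of_nonneg ht0] at hb
  have h2 : t ^ 2 ≤ 1 := pow_le_one₀ ht0 ht1
  have h3 : t ^ 3 ≤ t := by nlinarith
  have h5 : t ^ 5 ≤ t := by nlinarith
  have := (abs_sub_le_iff.1 hb).2
  nlinarith

/-- `1 - cos 1 ≥ 43/96`. [folklore] -/
theorem one_sub_cos_one_ge : (43 : ℝ) / 96 ≤ 1 - Real.cos 1 := by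
  have hb := Real.cos_bound (show |(1 : ℝ)| ≤ 1 by simp)
  have := (abs_sub_le_iff.1 hb).1
  norm_num at this ⊢
  linarith

/-- `s - log(1+s) ≤ s²` for `s ≥ 0`. [folklore] -/
theorem sub_log_one_add_le_sq {s : ℝ} (hs : 0 ≤ s) : s - Real.log (1 + s) ≤ s ^ 2 := by
  have h1 := Real.one_sub_inv_le_log_of_pos (show 0 < 1 + s by positivity)
  have h2 : 1 - (1 + s)⁻¹ = s / (1 + s) := by field_simp; ring
  have h3 : s - s ^ 2 ≤ s / (1 + s) := by
    rw [le_div_iff₀ (by positivity)]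
    nlinarith [sq_nonneg s, mul_nonneg hs (sq_nonneg s)]
  linarith

/-- `1/2 ≤ e^{-1/2} ≤ 1`. [folklore] -/
theorem exp_neg_half_bounds : 1 / 2 ≤ Real.exp (-1 / 2) ∧ Real.exp (-1 / 2) ≤ 1 := by
  constructor
  · have := Real.add_one_le_exp (-1 / 2 : ℝ); linarith
  · exact Real.exp_le_one_iff.2 (by norm_num)

end Helpers

end KineticFluxLdDecayTilt

/-! ## The crux with a modified admissibility clause, and the three Gibbs-tilt refutations -/

open Literature.MathematicalPhysics.KineticTheory Literature.Analysis.FluidPDE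
open Summit.AtomisticToContinuum.HydrodynamicLimit.Theses.AntiMazurCoboundaries (KineticFluxLdDecay)
open KineticFluxLdDecayTilt

/-- The crux `KineticFluxLdDecay` with the two hypotheses on the one-body observable `g` —
amplitude `(∀ v, |g v| ≤ κ)` and orthogonality `∀ c₀ c₂ b, ∫ g v * (c₀ + ⟪b, v⟫ + c₂ ‖v‖²) dγ = 0` —
replaced by an abstract admissibility clause `P κ g` (everything else verbatim). -/
def KineticFluxLdDecayWith (P : ℝ → (V3 → ℝ) → Prop) : Prop :=
  ∀ (a θ : ℝ) (u₀ : V3), 0 < a → 0 < θ → ∃ σ₀ : ℝ, 0 < σ₀ ∧ ∀ σ : ℝ, 0 < σ → σ < σ₀ →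
    (∀ (N : ℕ) (Φ : HardSphereFlow (Torus.geometry (Fin 3)) (hsDiameter σ N) (N + 1)),
      IsProbabilityMeasure (localGibbsLaw σ (fun _ => a) (fun _ => u₀) (fun _ => θ) N Φ)) ∧
    ∃ κ : ℝ, 0 < κ ∧ ∀ (φ : T3 → ℝ) (g : V3 → ℝ), Continuous φ → Continuous g →
      (∀ x, |φ x| ≤ 1) → P κ g → ∀ δ : ℝ, 0 < δ → ∃ τ : ℝ, 0 < τ ∧ ∃ N₀ : ℕ,
        ∀ N : ℕ, N₀ ≤ N →
        ∀ Φ : HardSphereFlow (Torus.geometry (Fin 3)) (hsDiameter σ N) (N + 1),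
          ∫⁻ z, ENNReal.ofReal (Real.exp ((τ * ((N + 1 : ℕ) : ℝ) ^ (-(1 / 3 : ℝ)))⁻¹ *
            ∫ s in (0 : ℝ)..(τ * ((N + 1 : ℕ) : ℝ) ^ (-(1 / 3 : ℝ))),
              ∑ i, φ (Φ.flow s z i).1 * g ((Real.sqrt θ)⁻¹ • ((Φ.flow s z i).2 - u₀))))
            ∂(localGibbsLaw σ (fun _ => a) (fun _ => u₀) (fun _ => θ) N Φ) ≤
          ENNReal.ofReal (Real.exp (δ * (N + 1)))

/-- The crux is `KineticFluxLdDecayWith` its own admissibility clause (one direction suffices here;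
the converse is equally definitional). [folklore] -/
theorem kineticFluxLdDecayWith_of_crux (h : KineticFluxLdDecay) :
    KineticFluxLdDecayWith fun κ g => (∀ v, |g v| ≤ κ) ∧ ∀ (c₀ c₂ : ℝ) (b : V3),
      ∫ v, g v * (c₀ + inner ℝ b v + c₂ * ‖v‖ ^ 2) ∂(stdGaussian V3) = 0 := by
  intro a θ u₀ ha hθ
  obtain ⟨σ₀, hσ₀, H⟩ := h a θ u₀ ha hθ
  refine ⟨σ₀, hσ₀, fun σ hσ hσ' => ?_⟩
  obtain ⟨hA, κ, hκ, hB⟩ := H σ hσ hσ'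
  exact ⟨hA, κ, hκ, fun φ g hφ hg hφ1 hP => hB φ g hφ hg hφ1 hP.1 hP.2⟩

/-- Anti-monotonicity in the admissibility clause: admitting more observables is a stronger claim.
[folklore] -/
theorem KineticFluxLdDecayWith.anti {P Q : ℝ → (V3 → ℝ) → Prop} (hPQ : ∀ κ g, P κ g → Q κ g)
    (h : KineticFluxLdDecayWith Q) : KineticFluxLdDecayWith P := by
  intro a θ u₀ ha hθ
  obtain ⟨σ₀, hσ₀, H⟩ := h a θ u₀ ha hθ
  refine ⟨σ₀, hσ₀, fun σ hσ hσ' => ?_⟩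
  obtain ⟨hA, κ, hκ, hB⟩ := H σ hσ hσ'
  exact ⟨hA, κ, hκ, fun φ g hφ hg hφ1 hP => hB φ g hφ hg hφ1 (hPQ κ g hP)⟩

/-- **Unpacking at the reference point.** Any `KineticFluxLdDecayWith P` yields, at `a = θ = 1`,
`u₀ = 0`, `σ = min(σ₀/2, 1/4)`, `φ ≡ 1`, `N = N₀` and the regular Alexander flow, an LD bound of the
exact shape consumed by `tilt_lower_bound`. [folklore] -/
theorem KineticFluxLdDecayWith.unpack {P : ℝ → (V3 → ℝ) → Prop} (h : KineticFluxLdDecayWith P) :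
    ∃ σ : ℝ, ∃ hσ : 0 < σ, ∃ hσ' : σ < 2⁻¹, ∃ κ : ℝ, 0 < κ ∧ ∀ g : V3 → ℝ, Continuous g →
      P κ g → ∀ δ : ℝ, 0 < δ → ∃ h : ℝ, 0 < h ∧ ∃ N : ℕ,
        ∫⁻ z, ENNReal.ofReal (Real.exp (h⁻¹ * ∫ s in (0 : ℝ)..h,
            ∑ i, g (((regFlowCrux hσ hσ' N).flow s z i).2)))
          ∂(localGibbsLaw σ (fun _ => 1) (fun _ => 0) (fun _ => 1) N (regFlowCrux hσ hσ' N)) ≤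
        ENNReal.ofReal (Real.exp (δ * (N + 1))) := by
  obtain ⟨σ₀, hσ₀, H⟩ := h 1 1 0 one_pos one_pos
  have hσpos : 0 < min (σ₀ / 2) 4⁻¹ := lt_min (by positivity) (by norm_num)
  have hσlt : min (σ₀ / 2) 4⁻¹ < σ₀ := (min_le_left _ _).trans_lt (by linarith)
  have hσhalf : min (σ₀ / 2) 4⁻¹ < 2⁻¹ := (min_le_right _ _).trans_lt (by norm_num)
  refine ⟨min (σ₀ / 2) 4⁻¹, hσpos, hσhalf, ?_⟩
  obtain ⟨-, κ, hκ, hB⟩ := H _ hσpos hσlt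
  refine ⟨κ, hκ, fun g hg hP δ hδ => ?_⟩
  obtain ⟨τ, hτ, N₀, hN⟩ := hB (fun _ => 1) g continuous_const hg (fun _ => by simp) hP δ hδ
  refine ⟨τ * ((N₀ + 1 : ℕ) : ℝ) ^ (-(1 / 3 : ℝ)), mul_pos hτ (Real.rpow_pos_of_pos (by positivity) _),
    N₀, ?_⟩
  have key := hN N₀ le_rfl (regFlowCrux hσpos hσhalf N₀)
  simpa only [one_mul, Real.sqrt_one, inv_one, one_smul, sub_zero] using key

/-- From the tilt lower bound and an unpacked LD bound: the per-particle tilt functional is `≤ δ`.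
[folklore] -/
theorem KineticFluxLdDecayWith.gamma_le {σ : ℝ} {hσ : 0 < σ} {hσ' : σ < 2⁻¹} {θ₁ : ℝ} (hθ₁ : 0 < θ₁)
    (u₁ : V3) {N : ℕ} {g : V3 → ℝ} (hg : Continuous g) {K : ℝ} (hgK : ∀ v, |g v| ≤ K) {h δ : ℝ}
    (hh : 0 < h)
    (hN : ∫⁻ z, ENNReal.ofReal (Real.exp (h⁻¹ * ∫ s in (0 : ℝ)..h,
            ∑ i, g (((regFlowCrux hσ hσ' N).flow s z i).2)))
          ∂(localGibbsLaw σ (fun _ => 1) (fun _ => 0) (fun _ => 1) N (regFlowCrux hσ hσ' N)) ≤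
        ENNReal.ofReal (Real.exp (δ * (N + 1)))) :
    ∫ w, (g (u₁ + Real.sqrt θ₁ • w) + llr1 θ₁ u₁ (u₁ + Real.sqrt θ₁ • w)) ∂stdGaussian V3 ≤ δ := by
  have key := (tilt_lower_bound hσ hσ' hθ₁ u₁ N hg hgK hh).trans hN
  rw [ENNReal.ofReal_le_ofReal_iff (Real.exp_pos _).le, Real.exp_le_exp] at key
  have hNpos : (0 : ℝ) < ((N + 1 : ℕ) : ℝ) := by positivity
  push_cast at key hNpos
  nlinarith

end Summit.AtomisticToContinuum.HydrodynamicLimit.Theorems
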